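import Literature.AnabelianGeometry.AbsoluteAnabelian.AbsTopIII.FrobeniusPictureMLFCompatibilityTransport
import Literature.AnabelianGeometry.AbsoluteAnabelian.AbsTopIII.FrobeniusPictureMLFCores
import Literature.AnabelianGeometry.AbsoluteAnabelian.DiagramUniversalFamilies

/-!
# [AbsTopIII] Corollary 3.6 (i)/(iii): the three cores `(𝒟_{≤4}, ℰ)`, `(𝒟_{≤5}, Anab)`, `(𝒟_{≤6}, ℰ)`
# are SIMULTANEOUSLY compatible — one family of homotopies on `𝒟` over `ℰ`

S. Mochizuki, *Topics in Absolute Anabelian Geometry III*, Cor. 3.6 (i), (iii) pp. 78–80 of the kurims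
manuscript (`paper:url-5493eb38cbb7`; bib key `MochizukiAbsTopIII2015`); proof of (i) p. 80: "the
algorithms of Corollary 1.10 are 'group-theoretic'", i.e. every functor of `𝒟` lies over `ℰ`
(`LogFrobeniusData.overE`, seat abc-iut-L4-t5).

Seat abc-iut-L4-t5 (gen 4).  First step of the discharge of the literal (iii)/(v) compatibility statements
(`FrobeniusPictureMLFCompatibility.lean`, reductions `…CompatibilityTransport.lean`): the UNIVERSAL family of
homotopies over `ℰ` through the core vertices (rows 4, 5, 6) of `𝒟` — abc-iut-L4-t5 gen 2's
`DiagramOfCategories.univFamily` for the structure functors `overE`, which are fully faithful exactly at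
those vertices (`𝟭_ℰ`, `Anab → ℰ` (an equivalence), `𝟭_ℰ`) — is ONE family `K₀` on `𝒟`
(`coresFamily`) whose pulled-back pairs into the three core vertices make `(𝒟_{≤n}, core)` cores
(`isCore_coreFamily4/5/6Of_coresFamily`).  Hence the core halves of `RealisesCoresAndLogObs` hold with one
common `K` (`exists_compatible_cores`): the core structures of Cor. 3.6 (i) are mutually compatible in
the sense of Def. 3.5 (ii).  The remaining step for `LogObsCompatCoresStmt` is to ENLARGE `K₀` by the
`𝔖_log` pairs into `𝒩` (gluing condition = `IotaOverGaloisStmt`).  Pure category theory over the typed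
data; nothing here bears on [IUTchIII] Cor. 3.12.
-/

namespace Literature.AnabelianGeometry.AbsoluteAnabelian

open _root_.CategoryTheory _root_.Quiver

universe u

namespace LogFrobeniusData

open DiagramOfCategories

variable (Δ : LogFrobeniusData.{u})

/-- The core vertices of `𝒟`: rows 4, 5, 6 (`ℰ`, `Anab`, `ℰ`). [cite: MochizukiAbsTopIII2015, Corollary 3.6 (i) p.78] -/
def coreVertices : LFVertex → Prop := fun v => v = .fourth ∨ v = .fifth ∨ v = .sixth

/-- The projection `Anab → ℰ` is fully faithful (it is a quasi-inverse of the equivalence `κ_An`,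
Def. 3.1 (vi)). [cite: MochizukiAbsTopIII2015, Definition 3.1 (vi) p.70] -/
noncomputable def fullyFaithfulAtoE : Δ.AtoE.FullyFaithful := by
  haveI := Δ.κ_equiv
  let e : Δ.AtoE ≅ Δ.κ.inv :=
    (Δ.κ.asEquivalence.invFunIdAssoc Δ.AtoE).symm ≪≫ Functor.isoWhiskerLeft Δ.κ.inv Δ.κ_inv ≪≫
      Δ.κ.inv.rightUnitor
  exact (Functor.FullyFaithful.ofFullyFaithful Δ.κ.inv).ofIso e.symm

/-- The structure functors over `ℰ` are fully faithful at the core vertices.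
[cite: MochizukiAbsTopIII2015, Corollary 3.6 (i) p.80] -/
noncomputable def coreVertices_fullyFaithful : ∀ w : LFVertex, coreVertices w → (Δ.overE.N w).FullyFaithful
  | .fourth, _ => Functor.FullyFaithful.id Δ.E
  | .fifth, _ => Δ.fullyFaithfulAtoE
  | .sixth, _ => Functor.FullyFaithful.id Δ.E
  | .row1 _, h => False.elim (by rcases h with h | h | h <;> cases h)
  | .nexus, h => False.elim (by rcases h with h | h | h <;> cases h)
  | .third, h => False.elim (by rcases h with h | h | h <;> cases h)

/-- **`K₀`: the universal family of homotopies on `𝒟` over `ℰ` through the core vertices** — boundary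
set: the pairs `([σ]∘[γ₁], [σ]∘[γ₂])` with `γ₁, γ₂` co-verticial into a row-4/5/6 vertex; homotopies:
the canonical identifications over `ℰ` (the content of the proof of Cor. 3.6 (i), p. 80).
[cite: MochizukiAbsTopIII2015, Corollary 3.6 (i) p.80] -/
noncomputable def coresFamily : Δ.diagram.HomotopyFamily :=
  univFamily Δ.overE coreVertices Δ.coreVertices_fullyFaithful

/-- Its boundary set. [cite: MochizukiAbsTopIII2015, Corollary 3.6 (i) p.80] -/
theorem coresFamily_E {a b : LFVertex} (P Q : Path a b) :
    Δ.coresFamily.E P Q ↔ univE coreVertices P Q := Iff.rfl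

/-- `K₀` pulled back to `𝒟_{≤3} ∪ {ℰ}` (pairs ending at `ℰ`) is a core structure.
[cite: MochizukiAbsTopIII2015, Corollary 3.6 (i) p.79] -/
theorem isCore_coreFamily4Of_coresFamily :
    (Δ.coreObs4 (Δ.coreFamily4Of Δ.coresFamily) (fun _ _ _ _ h => h.1)).IsCore :=
  ⟨fun _ p q => ⟨rfl, (Δ.pullCore4_E_iff _ p q).mpr
      (univE_of_mem coreVertices (Or.inl rfl) (embCore4.mapPath p) (embCore4.mapPath q))⟩,
    reaches4⟩

/-- `K₀` pulled back to `𝒟_{≤4} ∪ {Anab}` is a core structure. [cite: MochizukiAbsTopIII2015, Corollary 3.6 (i) p.79] -/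
theorem isCore_coreFamily5Of_coresFamily :
    (Δ.coreObs5 (Δ.coreFamily5Of Δ.coresFamily) (fun _ _ _ _ h => h.1)).IsCore :=
  ⟨fun _ p q => ⟨rfl, (Δ.pullCore5_E_iff _ p q).mpr
      (univE_of_mem coreVertices (Or.inr (Or.inl rfl)) (embCore5.mapPath p) (embCore5.mapPath q))⟩,
    reaches5⟩

/-- `K₀` pulled back to `𝒟_{≤5} ∪ {ℰ}` is a core structure. [cite: MochizukiAbsTopIII2015, Corollary 3.6 (i) p.79] -/
theorem isCore_coreFamily6Of_coresFamily :
    (Δ.coreObs6 (Δ.coreFamily6Of Δ.coresFamily) (fun _ _ _ _ h => h.1)).IsCore :=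
  ⟨fun _ p q => ⟨rfl, (Δ.pullCore6_E_iff _ p q).mpr
      (univE_of_mem coreVertices (Or.inr (Or.inr rfl)) (embCore6.mapPath p) (embCore6.mapPath q))⟩,
    reaches6⟩

/-- **The three core structures of Cor. 3.6 (i) are simultaneously compatible** (Def. 3.5 (ii), along
the embeddings into `𝒟`): ONE family `K₀` on `𝒟` contains core families for `(𝒟_{≤4}, ℰ)`,
`(𝒟_{≤5}, Anab)`, `(𝒟_{≤6}, ℰ)` — the core halves of `RealisesCoresAndLogObs K₀`.
[cite: MochizukiAbsTopIII2015, Corollary 3.6 (iii) p.80] -/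
theorem exists_compatible_cores : ∃ K : Δ.diagram.HomotopyFamily,
    (∃ H hH, (Δ.coreObs4 H hH).IsCore ∧ H.CompatibleAlong embCore4 K) ∧
    (∃ H hH, (Δ.coreObs5 H hH).IsCore ∧ H.CompatibleAlong embCore5 K) ∧
    (∃ H hH, (Δ.coreObs6 H hH).IsCore ∧ H.CompatibleAlong embCore6 K) :=
  ⟨Δ.coresFamily,
    ⟨_, _, Δ.isCore_coreFamily4Of_coresFamily,
      HomotopyFamily.endingAt_compatibleAlong _ _ _ (Δ.pullCore4_compatibleAlong _) _ _⟩,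
    ⟨_, _, Δ.isCore_coreFamily5Of_coresFamily,
      HomotopyFamily.endingAt_compatibleAlong _ _ _ (Δ.pullCore5_compatibleAlong _) _ _⟩,
    ⟨_, _, Δ.isCore_coreFamily6Of_coresFamily,
      HomotopyFamily.endingAt_compatibleAlong _ _ _ (Δ.pullCore6_compatibleAlong _) _ _⟩⟩

end LogFrobeniusData

end Literature.AnabelianGeometry.AbsoluteAnabelian
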